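import Literature.Probability.LatticeModels.DiluteLinkStates
import Literature.Probability.RandomPlanarGeometry.HexSAWStrip
import Mathlib.Combinatorics.SimpleGraph.Connectivity.Connected
import Mathlib.Data.Matrix.Mul
import Mathlib.Tactic.DeriveFintype
import HarnessLib

/-!
# The strip transfer matrix of the honeycomb `O(n)` loop model (column-to-column, free boundaries)

Definition request `defn-HexONTransferMatrix` (routes `CriticalPhenomena/SAWScalingLimit/`
`SAWLatticeVirasoro` — items `KooSaleurVirasoro`, `ConformalTowers` — and `SAWBetheAnsatz` — items
`StripGapFiveEighths`, `StripRateExists`, whose one-walk strip partition function `W(T,N)` lives on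
the same strip). Part 2 of 3 (part 1: `DiluteLinkStates.lean`; part 3: `DiluteFaceOperators.lean`).

Sources. The loop/`SAW` transfer-matrix formalism on connectivity states with arcs and strings:
J. L. Jacobsen, LNP 775 (2009) §14.7.2, eq. (14.184) `Z = ⟨v|T^M|u⟩` ("a *state* … consists of
*arcs* that connect pairs of points within one time slice, and `ℓ` *strings* … `T` transforms a
state from time `t₀` to `t₀+1` by acting on the upper time slice … `ℓ` cannot increase under the
action by `T`") [`Jacobsen2009`]; the algebraic rules "if two defects are connected or if a loop
segment is connected to a vacant site, the result is set to zero", closed loops weighted `β = n`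
[`MorinDuchesneKlumperPearce2023`, §3.3]; the honeycomb `O(n)` loop model
`Z = Σ_G K^{|G|} n^{l(G)}` [`Jacobsen2009`, §14.3.1 eq. (14.60)] with the vertex-counting length of
Duminil-Copin–Smirnov [`DuminilCopinSmirnov2012`, §1, §3 (strips)]. Context, not read here: the
Bethe-ansatz papers on exactly these strip transfer matrices [`BatchelorBlote1988`] (periodic),
[`BatchelorSuzuki1993`] (free boundaries), and the connectivity ("sparse-matrix") transfer matrices
of `O(n)` loops [`BloteNienhuis1989`].

## The strip, in the coordinate model `HV` of `HexSAWLattice.lean` / `HexSAWStrip.lean`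

The strip of width `T` is `{v : HV | 0 ≤ lev v ≤ 2T - 1}` (levels `lev (x₀,x₁,b) = 2x₁ + b`; the
parallelogram boxes of `SAWBetheAnsatz.StripGapFiveEighths` are its pieces `0 ≤ x₀ ≤ N`). Its
vertices are `colVertex c m = (c, m / 2, m odd)`, `c : ℤ` the COLUMN (`= x₀`), `m : Fin (2T)` the
level, and its edges are EXACTLY (`colVertex_adj_iff`): the column edges
`colVertex c m — colVertex c (m+1)` (each column is a path `U₀ D₀ U₁ D₁ ⋯ U_{T-1} D_{T-1}`,
`U_i` at level `2i`, `D_i` at level `2i+1`) and the `T` CUT EDGES between consecutive columns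
`D_i(c) = colVertex c (2i+1) — U_i(c+1) = colVertex (c+1) (2i)`, `i : Fin T` — the mid-edges on which
the link states live. The transfer direction is `x₀` (period `1`, slanted cut); in the regular
embedding a column has height `√3/2` per unit of `x₁`.

A loop configuration restricted to one column is a set of maximal runs of column edges; a run
covers an interval of levels `[a, b]`, `a < b`, and leaves the column through the ports of its two
end vertices (`U_i` owns the in-port = cut edge `i` to the left, `D_i` the out-port = cut edge `i`
to the right; interior vertices have degree `2` already). Hence a **column configuration** is a
set of pairwise disjoint STRANDS `(a, b)`, `a < b` (`colConfigs`), of weight `x^{Σ (b - a + 1)}`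
(`x` per visited vertex); strand `(a,b)` joins port `a` to port `b` (even level `2i` = in-port
`i`, odd level `2i+1` = out-port `i`).

## The transfer matrix (`HexON.transferMatrix T n x : Matrix (DiluteLink T) (DiluteLink T) R`)

Entry `(τ, σ)` (TARGET `τ` = link state on the right cut, SOURCE `σ` = link state on the left cut;
operators act on column vectors, `Matrix.mulVec`) = `Σ_γ x^{verts γ} n^{loops}` over the column
configurations `γ` COMPATIBLE with `(σ, τ)`: glue the arcs of `σ` (connections through the past)
to the strands of `γ` (`glue`, a simple graph on ports ⊕ strands ⊕ arcs); then (`Compatible`)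
the in-ports used by `γ` are exactly the occupied nodes of `σ` (no strand into a vacancy, no
occupied edge dangling), the out-ports used are the occupied nodes of `τ`, two defects of `σ` are
never joined, `τ` pairs `e, f` iff the out-ports `e ≠ f` are joined, `τ` marks `e` as a defect iff
out-port `e` is joined to a defect of `σ`, and every defect of `σ` comes out (through-lines are
conserved); `loops` = number of closed loops = connected components of the glued graph all of whose
vertices have exactly two neighbours. PROVED: entries are `≥ 0` for `n, x ≥ 0`
(`transferMatrix_nonneg`), the empty-to-empty entry is `1` (`transferMatrix_vacuum_vacuum`: the
trivial `n = 0` vacuum `Λ₀ = 1`), and the matrix is block diagonal in the number of defects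
(`defects_eq_of_compatible`, `transferMatrix_apply_of_defects_ne`), and so are its powers
(`transferMatrix_pow_apply_of_defects_ne`); `sectorTM T k` is the `k`-th block and
`sectorTM_pow : (sectorTM k)^m = (transferMatrix^m)` restricted to the sector.

## One polymer (`n = 0`, sector `k = 1`): boundary vectors

`sawIn T x τ` (column `0`: strands on out-ports plus ONE half-strand from the START vertex of the
walk to an out-port, or the start vertex `D_e` leaving at once) and `sawOut T n x σ` (last column:
strands on in-ports plus one half-strand from an in-port to the END vertex), both supported on the
one-defect sector (`sawIn_apply_of_defects_ne_one`, `sawOut_apply_of_defects_ne_one`);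
`polymerPF T n x m = sawOut ⬝ᵥ (transferMatrix^m *ᵥ sawIn)`, which therefore only involves the
one-defect block: `polymerPF_eq_sector : polymerPF = Σ_{τ σ ∈ Sector T 1} out τ ((sectorTM 1)^m) τ σ in σ`
("a matrix element of the power of the `k = 1` block", as the request puts it). REMARK (not proved
here; the intended sanity identity of the request): for `N ≥ 1`,
`polymerPF T 0 x (N - 1) = Σ_{SAW ω ⊂ columns 0..N, levels 0..2T-1, ω : column 0 → column N} x^{#ω}`,
i.e. `W(T,N)` of `SAWBetheAnsatz.StripRateExists` at `x = hexCriticalFugacity`; its proof is the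
bijection "walk ↦ (link states on the cuts, column configurations)". Likewise
`(transferMatrix^(N+1)) vacuum vacuum = Σ_{disjoint cycles C ⊂ columns 0..N} x^{#V(C)} n^{#C}` (loop
gas with empty cuts `0` and `N + 1`). Both identities were checked outside Lean by exhaustive
enumeration of the box for `T ≤ 3`, `N ≤ 4`, as polynomial identities in `x, n`, with the
definitions below transcribed literally (this is evidence for faithfulness, not a proof).

## Not here

The factorisation of `transferMatrix` into local dilute Temperley–Lieb face operators (one
`A₂⁽²⁾` vertex `U_i D_i` at a time, Blöte–Nienhuis sparse-matrix form) and the Hamiltonian densities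
are in part 3 (`DiluteFaceOperators.lean`), where the honeycomb vertex weights
`(1; x, x; x², x², x², x²; x², 0)` are identified with the `A₂⁽²⁾` face weights at `u = 2λ`,
`x = 1/(2 cos λ)`, `n = -2 cos 4λ`.
-/

noncomputable section

open Finset Matrix
open scoped Classical

namespace Literature.Probability.LatticeModels

namespace HexON

open Literature.Probability.RandomPlanarGeometry.SAW (HV hvGraph hvGraph_adj)
open Literature.Probability.RandomPlanarGeometry.SAW.HV (lev bit AdjRel)

variable {T : ℕ}

/-! ### The strip in the coordinate model: columns, levels, ports -/

/-- The levels `0, …, 2T-1` of the strip of width `T`. [cite: DuminilCopinSmirnov2012, §3] -/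
abbrev Level (T : ℕ) : Type := Fin (2 * T)

/-- The vertex of column `c` at level `m`: `(c, ⌊m/2⌋, m odd)` — `U_i = (c, i, false)` at level `2i`,
`D_i = (c, i, true)` at level `2i+1`. [cite: DuminilCopinSmirnov2012, §3 (Fig. 3)] -/
def colVertex (c : ℤ) (m : Level T) : HV := (c, ((m.val / 2 : ℕ) : ℤ), decide (m.val % 2 = 1))

/-- The in-port of node `i` is the level `2i` (vertex `U_i`, entered from the left cut edge `i`).
[folklore] -/
def inLevel (i : Fin T) : Level T := ⟨2 * i.val, by omega⟩

/-- The out-port of node `i` is the level `2i+1` (vertex `D_i`, left through the right cut edge `i`).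
[folklore] -/
def outLevel (i : Fin T) : Level T := ⟨2 * i.val + 1, by omega⟩

/-- `inLevel` in coordinates. [folklore] -/
@[simp] theorem inLevel_val (i : Fin T) : (inLevel i).val = 2 * i.val := rfl
/-- `outLevel` in coordinates. [folklore] -/
@[simp] theorem outLevel_val (i : Fin T) : (outLevel i).val = 2 * i.val + 1 := rfl

/-- `colVertex c m` is at level `m`. [cite: DuminilCopinSmirnov2012, §3] -/
theorem lev_colVertex (c : ℤ) (m : Level T) : lev (colVertex c m) = m := by
  unfold colVertex
  by_cases h : m.val % 2 = 1 <;> simp [h, bit] <;> omega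

/-- Every vertex of the strip (levels `0 ≤ lev v < 2T`) is a `colVertex` of its column `v.1`.
[folklore] -/
theorem exists_eq_colVertex (v : HV) (h0 : 0 ≤ lev v) (h1 : lev v < 2 * (T : ℤ)) :
    ∃ m : Level T, v = colVertex v.1 m := by
  obtain ⟨a, b, c⟩ := v
  refine ⟨⟨(lev (a, b, c)).toNat, by omega⟩, ?_⟩
  cases c <;> simp [colVertex, bit] at h0 h1 ⊢ <;> omega

/-- `colVertex` is injective in (column, level). [folklore] -/
theorem colVertex_inj {c c' : ℤ} {m m' : Level T} :
    colVertex c m = colVertex c' m' ↔ c = c' ∧ m = m' := by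
  constructor
  · intro h
    simp only [colVertex, Prod.mk.injEq, Nat.cast_inj, decide_eq_decide] at h
    refine ⟨h.1, Fin.ext ?_⟩
    omega
  · rintro ⟨rfl, rfl⟩; rfl

/-- **The edges of the strip**: two strip vertices are adjacent in the honeycomb lattice iff they
are consecutive levels of the same column, or they are the two ends `D_i(c)` (level `2i+1`) and
`U_i(c+1)` (level `2i`) of a cut edge between consecutive columns. [folklore] -/
theorem colVertex_adj_iff (c c' : ℤ) (m m' : Level T) :
    hvGraph.Adj (colVertex c m) (colVertex c' m') ↔
      (c' = c ∧ (m'.val = m.val + 1 ∨ m.val = m'.val + 1)) ∨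
      (c' = c + 1 ∧ m.val % 2 = 1 ∧ m'.val + 1 = m.val) ∨
      (c = c' + 1 ∧ m'.val % 2 = 1 ∧ m.val + 1 = m'.val) := by
  rw [hvGraph_adj, AdjRel]
  unfold colVertex
  by_cases h : m.val % 2 = 1 <;> by_cases h' : m'.val % 2 = 1 <;> simp [h, h'] <;> omega

/-- The column edges: consecutive levels of a column are adjacent. [folklore] -/
theorem colVertex_adj_succ (c : ℤ) (m m' : Level T) (h : m'.val = m.val + 1) :
    hvGraph.Adj (colVertex c m) (colVertex c m') :=
  (colVertex_adj_iff c c m m').2 (Or.inl ⟨rfl, Or.inl h⟩)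

/-- The cut edges: the out-port vertex `D_i` of column `c` is adjacent to the in-port vertex `U_i`
of column `c + 1`. [folklore] -/
theorem colVertex_out_adj_in (c : ℤ) (i : Fin T) :
    hvGraph.Adj (colVertex c (outLevel i)) (colVertex (c + 1) (inLevel i)) :=
  (colVertex_adj_iff _ _ _ _).2 (Or.inr (Or.inl ⟨rfl, by simp, by simp⟩))

/-! ### Column configurations -/

/-- The possible strands of a column: intervals of levels `(a, b)` with `a < b` (a run of column
edges from level `a` to level `b`, leaving through the ports of `a` and `b`). [cite: Jacobsen2009, §14.7.2] -/
def strands (T : ℕ) : Finset (Level T × Level T) := univ.filter fun p => p.1 < p.2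

/-- **Column configurations**: sets of pairwise vertex-disjoint strands (the restrictions of loop /
walk configurations to one column of the strip). [cite: Jacobsen2009, §14.7.2] -/
def colConfigs (T : ℕ) : Finset (Finset (Level T × Level T)) :=
  (strands T).powerset.filter fun γ => ∀ p ∈ γ, ∀ q ∈ γ, p ≠ q → (p.2 < q.1 ∨ q.2 < p.1)

/-- The number of column vertices visited by a configuration (each strand `(a,b)` visits
`b - a + 1`); the weight is `x ^ verts` — `x` per visited VERTEX, the convention of
Duminil-Copin–Smirnov ("the length `ℓ(γ)` of the walk is the number of vertices visited by `γ`")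
and of `W(T,N)`; for closed loops this is Nienhuis' `K` per edge, Jacobsen (14.60).
[cite: DuminilCopinSmirnov2012, §1; Jacobsen2009, §14.3.1 eq. (14.60)] -/
def verts (γ : Finset (Level T × Level T)) : ℕ := ∑ p ∈ γ, (p.2.val - p.1.val + 1)

/-- The ports (levels) used by a configuration: the two ends of each strand. [folklore] -/
def used (γ : Finset (Level T × Level T)) : Finset (Level T) := γ.biUnion fun p => {p.1, p.2}

/-- Membership in `colConfigs`. [folklore] -/
theorem mem_colConfigs_iff {γ : Finset (Level T × Level T)} :
    γ ∈ colConfigs T ↔ (∀ p ∈ γ, p.1 < p.2) ∧ ∀ p ∈ γ, ∀ q ∈ γ, p ≠ q → (p.2 < q.1 ∨ q.2 < p.1) := by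
  simp [colConfigs, strands, subset_iff]

/-- The empty column configuration. [folklore] -/
theorem empty_mem_colConfigs : (∅ : Finset (Level T × Level T)) ∈ colConfigs T := by
  simp [mem_colConfigs_iff]

/-- A configuration using no port is empty (every strand has two ends). [folklore] -/
theorem eq_empty_of_used_eq_empty {γ : Finset (Level T × Level T)} (h : used γ = ∅) : γ = ∅ := by
  rw [eq_empty_iff_forall_notMem] at h ⊢
  intro p hp
  exact h p.1 (by rw [used, mem_biUnion]; exact ⟨p, hp, by simp⟩)

/-! ### Gluing the past to a column: connectivity and closed loops -/

/-- The vertices of the glued graph: the `2T` ports of the column, its possible strands, the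
possible arcs of the incoming link state (indexed by node pairs), and — for the one-polymer
boundary vectors — a half-strand and the terminal (start/end vertex of the walk). [folklore] -/
inductive Node (T : ℕ) : Type
  | port (m : Level T)
  | strand (p : Level T × Level T)
  | arcN (q : Fin T × Fin T)
  | half
  | term
  deriving DecidableEq, Fintype

/-- A half-strand `(a, b, top)`: the interval of levels `a ≤ b` run by the first (or last) piece of
a walk inside its first (last) column, between the walk's endpoint and the port end — the port end
is `b` if `top` and `a` otherwise (for a single vertex `a = b` only `top = true` is kept, so that
each half-strand is listed once). [folklore] -/
def halfStrands (T : ℕ) : Finset (Level T × Level T × Bool) :=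
  univ.filter fun h => h.1 ≤ h.2.1 ∧ (h.1 = h.2.1 → h.2.2 = true)

/-- The port end of a half-strand. [folklore] -/
def portEnd (h : Level T × Level T × Bool) : Level T := if h.2.2 then h.2.1 else h.1

/-- The number of vertices of a half-strand. [folklore] -/
def hverts (h : Level T × Level T × Bool) : ℕ := h.2.1.val - h.1.val + 1

/-- The incidence relation of the glued graph: port `m` — strand `p ∈ γ` if `m` is an end of `p`;
in-port `2i` — arc `(i, j)` / `(j, i)` of `σ` (`i < j` listed once); the port end of the half-strand —
`half` — `term`. [cite: Jacobsen2009, §14.7.2 (Fig. 14.16)] -/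
def glueRel (σ : DiluteLink T) (γ : Finset (Level T × Level T))
    (h : Option (Level T × Level T × Bool)) : Node T → Node T → Prop
  | .port m, .strand p => p ∈ γ ∧ (m = p.1 ∨ m = p.2)
  | .port m, .arcN q => q.1 < q.2 ∧ σ.slot q.1 = .arc q.2 ∧ (m = inLevel q.1 ∨ m = inLevel q.2)
  | .port m, .half => ∃ hs, h = some hs ∧ m = portEnd hs
  | .half, .term => h.isSome
  | _, _ => False

/-- **The glued graph** of an incoming link state `σ`, a column configuration `γ` and an optional
half-strand: its paths are the pieces of loops/walks seen from the right cut. [cite: Jacobsen2009, §14.7.2] -/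
def glue (σ : DiluteLink T) (γ : Finset (Level T × Level T))
    (h : Option (Level T × Level T × Bool)) : SimpleGraph (Node T) :=
  SimpleGraph.fromRel (glueRel σ γ h)

/-- A connected component is a **closed loop** iff each of its vertices has exactly two
neighbours. [folklore] -/
def IsLoop (G : SimpleGraph (Node T)) (c : G.ConnectedComponent) : Prop :=
  ∀ v, G.connectedComponentMk v = c → ∃ a b, a ≠ b ∧ ∀ w, G.Adj v w ↔ (w = a ∨ w = b)

/-- The number of closed loops of a glued graph (each weighted `n`, Jacobsen (14.60):
`Z = Σ_G K^{|G|} n^{l(G)}`). [cite: Jacobsen2009, §14.3.1 eq. (14.60)] -/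
def loops (G : SimpleGraph (Node T)) : ℕ := Nat.card {c : G.ConnectedComponent // IsLoop G c}

/-! ### The transfer matrix -/

/-- **Compatibility of (source state, column configuration, target state)** — the rules of the
action of a diagram on a link state [MDKP §3.3] in the honeycomb geometry: strands enter exactly
the occupied in-ports, leave exactly through the occupied out-ports, never join two defects; the
target pairs two nodes iff their out-ports are joined through the column and the past, marks a
node as a defect iff its out-port is joined to an incoming defect, and every incoming defect
(through-line) comes out. [cite: MorinDuchesneKlumperPearce2023, §3.3 (action on link states)] -/
structure Compatible (σ : DiluteLink T) (γ : Finset (Level T × Level T)) (τ : DiluteLink T) : Prop where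
  in_used : ∀ i, inLevel i ∈ used γ ↔ σ.occ i
  out_used : ∀ e, outLevel e ∈ used γ ↔ τ.occ e
  defects_apart : ∀ i j, σ.IsDefect i → σ.IsDefect j → i ≠ j →
    ¬ (glue σ γ none).Reachable (.port (inLevel i)) (.port (inLevel j))
  arc_iff : ∀ e f, τ.slot e = .arc f ↔
    e ≠ f ∧ (glue σ γ none).Reachable (.port (outLevel e)) (.port (outLevel f))
  defect_iff : ∀ e, τ.IsDefect e ↔
    ∃ i, σ.IsDefect i ∧ (glue σ γ none).Reachable (.port (outLevel e)) (.port (inLevel i))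
  through : ∀ i, σ.IsDefect i → ∃ e, (glue σ γ none).Reachable (.port (inLevel i)) (.port (outLevel e))

variable (R : Type*) [CommSemiring R]

/-- **The column-to-column transfer matrix of the honeycomb `O(n)` loop model on the strip of width
`T` with free boundaries**, on planar dilute link states of the `T` cut edges: entry (target `τ`,
source `σ`) `= Σ_{γ compatible} x^{#vertices of γ} · n^{#closed loops}`.
[cite: Jacobsen2009, §14.3.1 eq. (14.60) and §14.7.2 eq. (14.184)] -/
def transferMatrix (T : ℕ) (n x : R) : Matrix (DiluteLink T) (DiluteLink T) R :=
  Matrix.of fun τ σ => ∑ γ ∈ colConfigs T,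
    if Compatible σ γ τ then x ^ verts γ * n ^ loops (glue σ γ none) else 0

variable {R}

/-- Unfolding the transfer matrix. [folklore] -/
theorem transferMatrix_apply (n x : R) (τ σ : DiluteLink T) :
    transferMatrix R T n x τ σ = ∑ γ ∈ colConfigs T,
      if Compatible σ γ τ then x ^ verts γ * n ^ loops (glue σ γ none) else 0 := rfl

/-- **The `k`-defect block** of the transfer matrix (sector with `k` through-lines: `k = 0` loops
only, `k = 1` one polymer, `k = 2` two mutually avoiding lines, …). [cite: Jacobsen2009, §14.7.2 (T_ℓ)] -/
def sectorTM (R : Type*) [CommSemiring R] (T k : ℕ) (n x : R) :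
    Matrix (DiluteLink.Sector T k) (DiluteLink.Sector T k) R :=
  (transferMatrix R T n x).submatrix Subtype.val Subtype.val

/-! ### Proved properties -/

/-- For `n, x ≥ 0` the transfer matrix is entrywise nonnegative (a Perron–Frobenius object).
[folklore] -/
theorem transferMatrix_nonneg {n x : ℝ} (hn : 0 ≤ n) (hx : 0 ≤ x) (τ σ : DiluteLink T) :
    0 ≤ transferMatrix ℝ T n x τ σ := by
  rw [transferMatrix_apply]
  refine sum_nonneg fun γ _ => ?_
  split_ifs
  · exact mul_nonneg (pow_nonneg hx _) (pow_nonneg hn _)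
  · exact le_rfl

/-- With the empty state on both cuts nothing is glued: the glued graph of the vacuum and the empty
configuration has no edge. [folklore] -/
theorem glue_vacuum_empty : glue (DiluteLink.vacuum T) ∅ none = ⊥ := by
  ext v w
  simp only [glue, SimpleGraph.fromRel_adj, SimpleGraph.bot_adj, iff_false, not_and, not_or]
  intro _
  constructor <;> cases v <;> cases w <;> simp [glueRel]

/-- A graph without edges has no closed loop. [folklore] -/
theorem loops_bot : loops (⊥ : SimpleGraph (Node T)) = 0 := by
  rw [loops, Nat.card_eq_zero]
  left
  refine ⟨fun ⟨c, hc⟩ => ?_⟩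
  induction c using SimpleGraph.ConnectedComponent.ind with
  | h v =>
    obtain ⟨a, b, -, h⟩ := hc v rfl
    exact (SimpleGraph.bot_adj v a).1 ((h a).2 (Or.inl rfl))

/-- Only the empty configuration is compatible with the vacuum on both cuts. [folklore] -/
theorem compatible_vacuum_iff {γ : Finset (Level T × Level T)} :
    Compatible (DiluteLink.vacuum T) γ (DiluteLink.vacuum T) ↔ γ = ∅ := by
  constructor
  · intro h
    apply eq_empty_of_used_eq_empty
    rw [eq_empty_iff_forall_notMem]
    intro m hm
    rcases Nat.even_or_odd m.val with ⟨k, hk⟩ | ⟨k, hk⟩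
    · have := (h.in_used ⟨k, by omega⟩).1 (by convert hm; exact Fin.ext (by simp; omega))
      simp at this
    · have := (h.out_used ⟨k, by omega⟩).1 (by convert hm; exact Fin.ext (by simp; omega))
      simp at this
  · rintro rfl
    refine ⟨fun i => by simp [used], fun e => by simp [used], fun i j hi => by simp at hi,
      fun e f => ?_, fun e => by simp [DiluteLink.IsDefect], fun i hi => by simp at hi⟩
    simp only [DiluteLink.vacuum_slot, reduceCtorEq, ne_eq, false_iff, not_and]
    intro hef hr
    rw [glue_vacuum_empty, SimpleGraph.reachable_bot] at hr
    exact hef (by simpa [outLevel, Fin.ext_iff] using hr)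

/-- **The trivial vacuum**: the empty-to-empty entry of the transfer matrix is `1` (only the empty
column contributes; at `n = 0` this is the eigenvalue `Λ₀ = 1` from which the Cardy gaps of
`SAWBetheAnsatz` are measured). [cite: Jacobsen2009, §14.7.2] -/
theorem transferMatrix_vacuum_vacuum (n x : R) :
    transferMatrix R T n x (DiluteLink.vacuum T) (DiluteLink.vacuum T) = 1 := by
  rw [transferMatrix_apply, sum_eq_single_of_mem ∅ empty_mem_colConfigs]
  · rw [if_pos (compatible_vacuum_iff.2 rfl), glue_vacuum_empty, loops_bot]
    simp [verts]
  · intro γ _ hγ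
    rw [if_neg (fun h => hγ (compatible_vacuum_iff.1 h))]

/-- **Conservation of through-lines**: a compatible step carries the defects of the source
bijectively onto the defects of the target (`ℓ` is conserved; with the "two defects never join"
rule the transfer matrix is block DIAGONAL in the number of defects). [cite: Jacobsen2009, §14.7.2] -/
theorem defects_eq_of_compatible {σ τ : DiluteLink T} {γ : Finset (Level T × Level T)}
    (h : Compatible σ γ τ) : τ.defects = σ.defects := by
  unfold DiluteLink.defects
  have hex : ∀ e ∈ τ.defectSet, ∃ i, σ.IsDefect i ∧
      (glue σ γ none).Reachable (.port (outLevel e)) (.port (inLevel i)) :=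
    fun e he => (h.defect_iff e).1 (DiluteLink.mem_defectSet.1 he)
  refine card_bij (fun e he => Classical.choose (hex e he)) (fun e he => ?_) (fun e₁ he₁ e₂ he₂ hEq => ?_)
    (fun i hi => ?_)
  · exact DiluteLink.mem_defectSet.2 (Classical.choose_spec (hex e he)).1
  · by_contra hne
    have h₁ := (Classical.choose_spec (hex e₁ he₁)).2
    have h₂ := (Classical.choose_spec (hex e₂ he₂)).2
    rw [hEq] at h₁
    have harc := (h.arc_iff e₁ e₂).2 ⟨hne, h₁.trans h₂.symm⟩
    have hdef : τ.slot e₁ = .defect := DiluteLink.mem_defectSet.1 he₁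
    rw [hdef] at harc
    cases harc
  · have hi' : σ.IsDefect i := DiluteLink.mem_defectSet.1 hi
    obtain ⟨e, he⟩ := h.through i hi'
    have hed : τ.IsDefect e := (h.defect_iff e).2 ⟨i, hi', he.symm⟩
    refine ⟨e, DiluteLink.mem_defectSet.2 hed, ?_⟩
    by_contra hne
    have hspec := Classical.choose_spec (hex e (DiluteLink.mem_defectSet.2 hed))
    exact h.defects_apart _ _ hspec.1 hi' hne (hspec.2.symm.trans he.symm)

/-- Off-diagonal blocks vanish: between sectors with different numbers of defects every entry of
the transfer matrix is `0`. [cite: Jacobsen2009, §14.7.2] -/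
theorem transferMatrix_apply_of_defects_ne (n x : R) {τ σ : DiluteLink T} (hne : τ.defects ≠ σ.defects) :
    transferMatrix R T n x τ σ = 0 := by
  rw [transferMatrix_apply]
  refine sum_eq_zero fun γ _ => ?_
  rw [if_neg (fun h => hne (defects_eq_of_compatible h))]

/-! ### One polymer: boundary vectors and the strip partition function -/

/-- **Column `0` of a walk** (start column) producing the link state `τ` on cut `1`: the strands `γ`
and the half-strand `h` (from the START vertex to its port end, an out-port) are disjoint, use no
in-port (the left side of the box is closed), use exactly the out-ports occupied in `τ`; `τ` pairs the
two ends of each strand and its unique defect is the port of the half-strand. [cite: Jacobsen2009, §14.7.2 (initial state |u⟩)] -/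
structure StartCompatible (γ : Finset (Level T × Level T)) (h : Level T × Level T × Bool)
    (τ : DiluteLink T) : Prop where
  disjoint : ∀ p ∈ γ, p.2 < h.1 ∨ h.2.1 < p.1
  no_in : ∀ i, inLevel i ∉ used γ ∧ inLevel i ≠ portEnd h
  out_used : ∀ e, (outLevel e ∈ used γ ∨ outLevel e = portEnd h) ↔ τ.occ e
  arc_iff : ∀ e f, τ.slot e = .arc f ↔ e ≠ f ∧
    (glue (DiluteLink.vacuum T) γ (some h)).Reachable (.port (outLevel e)) (.port (outLevel f))
  defect_iff : ∀ e, τ.IsDefect e ↔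
    (glue (DiluteLink.vacuum T) γ (some h)).Reachable (.port (outLevel e)) .term
  start_defect : ∀ e, outLevel e = portEnd h → τ.IsDefect e

/-- **Last column of a walk** receiving the link state `σ`: strands and the half-strand (from an
in-port to the END vertex) are disjoint, use no out-port (the right side of the box is closed), use
exactly the in-ports occupied in `σ`, never join two defects, and the incoming through-line ends at
the terminal. Closed loops (a strand closing an arc of `σ`) are counted by `loops`. [cite: Jacobsen2009, §14.7.2 (final state ⟨v|)] -/
structure EndCompatible (σ : DiluteLink T) (γ : Finset (Level T × Level T))
    (h : Level T × Level T × Bool) : Prop where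
  disjoint : ∀ p ∈ γ, p.2 < h.1 ∨ h.2.1 < p.1
  no_out : ∀ e, outLevel e ∉ used γ ∧ outLevel e ≠ portEnd h
  in_used : ∀ i, (inLevel i ∈ used γ ∨ inLevel i = portEnd h) ↔ σ.occ i
  defects_apart : ∀ i j, σ.IsDefect i → σ.IsDefect j → i ≠ j →
    ¬ (glue σ γ (some h)).Reachable (.port (inLevel i)) (.port (inLevel j))
  through : ∀ i, σ.IsDefect i → (glue σ γ (some h)).Reachable (.port (inLevel i)) .term
  term_defect : ∃ i, σ.IsDefect i ∧ (glue σ γ (some h)).Reachable (.port (inLevel i)) .term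

variable (R)

/-- **Initial vector of one polymer**: weight `x^{#vertices in column 0}` summed over the start
columns producing `τ`. [cite: Jacobsen2009, §14.7.2 eq. (14.184)] -/
def sawIn (T : ℕ) (x : R) : DiluteLink T → R := fun τ =>
  ∑ γ ∈ colConfigs T, ∑ h ∈ halfStrands T,
    if StartCompatible γ h τ then x ^ (verts γ + hverts h) else 0

/-- **Final covector of one polymer**: weight `x^{#vertices in the last column} n^{#loops closed}`
summed over the end columns absorbing `σ`. [cite: Jacobsen2009, §14.7.2 eq. (14.184)] -/
def sawOut (T : ℕ) (n x : R) : DiluteLink T → R := fun σ =>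
  ∑ γ ∈ colConfigs T, ∑ h ∈ halfStrands T,
    if EndCompatible σ γ h then x ^ (verts γ + hverts h) * n ^ loops (glue σ γ (some h)) else 0

/-- **The one-polymer strip partition function** `⟨out| 𝐓^m |in⟩`: configurations of one
self-avoiding through-line (plus, for `n ≠ 0`, closed loops of weight `n`) spanning the columns
`0, …, m + 1` of the strip of width `T`, weight `x` per vertex. At `n = 0`, `x = hexCriticalFugacity`
this is the intended transfer-matrix form of `W(T, m+1)` of `SAWBetheAnsatz.StripRateExists`
(identity not proved in this file). [cite: Jacobsen2009, §14.7.2 eq. (14.184); Derrida1981] -/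
def polymerPF (T : ℕ) (n x : R) (m : ℕ) : R :=
  sawOut R T n x ⬝ᵥ ((transferMatrix R T n x) ^ m *ᵥ sawIn R T x)

variable {R}

/-- The initial vector lives in the one-defect sector. [folklore] -/
theorem sawIn_apply_of_defects_ne_one (x : R) {τ : DiluteLink T} (hτ : τ.defects ≠ 1) :
    sawIn R T x τ = 0 := by
  refine sum_eq_zero fun γ _ => sum_eq_zero fun h _ => ?_
  rw [if_neg]
  intro hc
  apply hτ
  -- the unique defect is the node of the port end of the half-strand
  have hodd : (portEnd h).val % 2 = 1 := by
    by_contra hev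
    obtain ⟨k, hk⟩ : ∃ k, (portEnd h).val = 2 * k := ⟨(portEnd h).val / 2, by omega⟩
    exact (hc.no_in ⟨k, by omega⟩).2 (Fin.ext (by simp [hk]))
  set e₀ : Fin T := ⟨(portEnd h).val / 2, by omega⟩ with he₀
  have hout : outLevel e₀ = portEnd h := Fin.ext (by simp [he₀]; omega)
  have hdef : τ.IsDefect e₀ := hc.start_defect e₀ hout
  rw [DiluteLink.defects, card_eq_one]
  refine ⟨e₀, eq_singleton_iff_unique_mem.2 ⟨DiluteLink.mem_defectSet.2 hdef, fun e he => ?_⟩⟩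
  by_contra hne
  have h1 := (hc.defect_iff e).1 (DiluteLink.mem_defectSet.1 he)
  have h2 := (hc.defect_iff e₀).1 hdef
  have harc := (hc.arc_iff e e₀).2 ⟨hne, h1.trans h2.symm⟩
  rw [show τ.slot e = .defect from DiluteLink.mem_defectSet.1 he] at harc
  cases harc

/-- The final covector lives in the one-defect sector. [folklore] -/
theorem sawOut_apply_of_defects_ne_one (n x : R) {σ : DiluteLink T} (hσ : σ.defects ≠ 1) :
    sawOut R T n x σ = 0 := by
  refine sum_eq_zero fun γ _ => sum_eq_zero fun h _ => ?_
  rw [if_neg]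
  intro hc
  apply hσ
  obtain ⟨i₀, hi₀, hr₀⟩ := hc.term_defect
  rw [DiluteLink.defects, card_eq_one]
  refine ⟨i₀, eq_singleton_iff_unique_mem.2 ⟨DiluteLink.mem_defectSet.2 hi₀, fun i hi => ?_⟩⟩
  by_contra hne
  have hi' := DiluteLink.mem_defectSet.1 hi
  exact hc.defects_apart i i₀ hi' hi₀ hne ((hc.through i hi').trans hr₀.symm)

/-! ### Block structure of the powers; the polymer partition function in the one-defect block -/

/-- Powers of the transfer matrix are block diagonal in the number of defects. [cite: Jacobsen2009, §14.7.2] -/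
theorem transferMatrix_pow_apply_of_defects_ne (n x : R) (m : ℕ) {τ σ : DiluteLink T}
    (hne : τ.defects ≠ σ.defects) : (transferMatrix R T n x ^ m) τ σ = 0 := by
  induction m generalizing τ σ with
  | zero => rw [pow_zero, Matrix.one_apply, if_neg (fun h => hne (by rw [h]))]
  | succ m ih =>
    rw [pow_succ, Matrix.mul_apply]
    refine sum_eq_zero fun μ _ => ?_
    by_cases h : μ.defects = σ.defects
    · rw [ih (fun h' => hne (h'.trans h)), zero_mul]
    · rw [transferMatrix_apply_of_defects_ne n x h, mul_zero]

/-- A sum over all link states of a function vanishing outside the `k`-defect sector is the sum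
over the sector. [folklore] -/
theorem sum_eq_sum_sector {M : Type*} [AddCommMonoid M] (k : ℕ) (f : DiluteLink T → M)
    (hf : ∀ μ, μ.defects ≠ k → f μ = 0) : ∑ μ, f μ = ∑ μ : DiluteLink.Sector T k, f μ.1 := by
  rw [← sum_subtype (univ.filter fun μ : DiluteLink T => μ.defects = k) (by simp)]
  exact (sum_filter_of_ne fun μ _ h => by by_contra h'; exact h (hf μ h')).symm

/-- **The diagonal blocks of the powers are the powers of the blocks**: `(sectorTM k)^m` is the
`k`-defect block of `transferMatrix^m`. [cite: Jacobsen2009, §14.7.2] -/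
theorem sectorTM_pow (k : ℕ) (n x : R) (m : ℕ) :
    sectorTM R T k n x ^ m = (transferMatrix R T n x ^ m).submatrix Subtype.val Subtype.val := by
  induction m with
  | zero => rw [pow_zero, pow_zero, submatrix_one _ Subtype.val_injective]
  | succ m ih =>
    rw [pow_succ, pow_succ, ih]
    ext τ σ
    simp only [sectorTM, Matrix.mul_apply, Matrix.submatrix_apply]
    rw [sum_eq_sum_sector k (fun μ => (transferMatrix R T n x ^ m) τ.1 μ * transferMatrix R T n x μ σ.1)]
    intro μ hμ
    rw [transferMatrix_apply_of_defects_ne n x (by rw [σ.2]; exact hμ), mul_zero]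

/-- **The polymer partition function is a one-defect-block quantity**: `⟨out| 𝐓^m |in⟩` only
involves the block `sectorTM T 1` (one through-line), as the boundary vectors live in that sector.
[cite: Jacobsen2009, §14.7.2 eq. (14.184)] -/
theorem polymerPF_eq_sector (n x : R) (m : ℕ) :
    polymerPF R T n x m = ∑ τ : DiluteLink.Sector T 1, ∑ σ : DiluteLink.Sector T 1,
      sawOut R T n x τ.1 * ((sectorTM R T 1 n x ^ m) τ σ * sawIn R T x σ.1) := by
  rw [polymerPF, dotProduct, sum_eq_sum_sector 1]
  · refine sum_congr rfl fun τ _ => ?_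
    rw [Matrix.mulVec, dotProduct, sum_eq_sum_sector 1, mul_sum]
    · refine sum_congr rfl fun σ _ => ?_
      rw [sectorTM_pow, Matrix.submatrix_apply]
    · intro σ hσ
      rw [sawIn_apply_of_defects_ne_one x hσ, mul_zero]
  · intro τ hτ
    rw [sawOut_apply_of_defects_ne_one n x hτ, zero_mul]

end HexON

/-- **The honeycomb `O(n)` strip transfer matrix** (alias at the topic namespace): width `T`, loop
weight `n`, vertex fugacity `x`, free boundaries, column-to-column in the `HV` model; see
`HexON.transferMatrix`. The critical polymer case of routes `SAWBetheAnsatz` / `SAWLatticeVirasoro` is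
`hexONTransferMatrix ℝ T 0 hexCriticalFugacity`. [cite: Jacobsen2009, §14.3.1 eq. (14.60) and §14.7.2 eq. (14.184)] -/
abbrev hexONTransferMatrix (R : Type*) [CommSemiring R] (T : ℕ) (n x : R) :
    Matrix (DiluteLink T) (DiluteLink T) R :=
  HexON.transferMatrix R T n x

end Literature.Probability.LatticeModels

end
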